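import Summits.AtomisticToContinuum.BoseEinsteinCondensation.Theses.BECInfraredBound
import Summits.AtomisticToContinuum.BoseEinsteinCondensation.Theorems.BECThomsonPrincipleGDTransferWindowLaw

/-!
# Candidate proof of the crux `BecWindowCount` (stmt-AtomisticToContinuum-9015) — crux-ideate evidence

Route `BECInfraredBound`, sub-problem `BoseEinsteinCondensation`.  Written by the crux ideator
(planner, round 1, ideator 1) as the IN-LEAN CHEAPEST FALSIFIER of its idea card
`integer-radius-cube-transfer` (two moves: idea A = punctured-cube transfer, idea B = cubic homogeneity);
it is EVIDENCE attached to the item, not a Theorems/ proposal (planners do not land proofs) — a prover may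
land it verbatim under `Summits/AtomisticToContinuum/BoseEinsteinCondensation/Theorems/`.
CONVERGENCE NOTE: ideator 2's independently filed card `in-tree-counts-homogeneous` (seen only after this
file was complete) uses the same lever and also closes the crux; the two files are independent
kernel-checked confirmations of ONE idea.

THE PROOF.  Write `s = √ρ·L_N`, `R = K·s`, `M = ⌊R⌋₊`.
* (idea A) the window subtype `{k ≠ 0 ∧ ‖k‖∞ ≤ R}` injects into the punctured lattice cube
  `{-M,…,M}³ ∖ 0` (`ModeCounting.mem_latticeBox_floor_of_norm_le`), so the `ℝ≥0∞` window `tsum` of the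
  profile `ofReal (C(1 + s/‖k‖∞))` is at most `ofReal` of its FINSET sum over the punctured cube
  (`ENNReal.tsum_comp_le_tsum_of_injective`, `Finset.tsum_subtype`, `ENNReal.ofReal_sum_of_nonneg`);
* (idea B) integrality absorbs all lower-order terms: `#({-M,…,M}³ ∖ 0) = (2M+1)³ − 1 ≤ 26M³`
  (`DysonDressedWitness.card_latticeShell_le`) and `Σ 1/‖k‖∞ ≤ 26M²`
  (`ModeCounting.sum_inv_norm_latticeShell_le_sq`), so the Finset sum is `≤ 26M³ + 26sM² ≤ 26(K³+K²)s³`,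
  and `s³ = √ρ·N` EXACTLY (`BoseGas.sideLength_pow_three`): the window mass is `≤ 26C(K³+K²)√ρ·N` for
  EVERY `N` — no eventuality beyond the infrared bound's own, and `ρ₀ := min ρ₀^IR (η/(26C(K³+K²)))²`.

References: [LSSY2005] Lieb–Seiringer–Solovej–Yngvason 2005, Ch. 11 (11.26)–(11.27) (mode counting:
finiteness of the infrared mode sum in `d ≥ 3`); [DysonLiebSimon1978] §4; [KLS1988PRL].
-/

noncomputable section

open Filter
open scoped ENNReal BigOperators

namespace Summit.AtomisticToContinuum.BoseEinsteinCondensation.Cruxes.BecWindowCount.Candidate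

open Literature.MathematicalPhysics.QuantumManyBody.BoseGas
open Summit.AtomisticToContinuum.BoseEinsteinCondensation.Theorems.ModeCounting
open Summit.AtomisticToContinuum.BoseEinsteinCondensation.Cruxes.GDTransfer.DysonDressedWitness
  (card_latticeShell_le)

/-! ## Idea A (`punctured-cube-transfer`): window `tsum` ≤ Finset sum over the punctured cube

The window subtype `{k ≠ 0 ∧ ‖k‖∞ ≤ R}` injects into the punctured lattice cube of radius `⌊R⌋₊`
(`mem_latticeBox_floor_of_norm_le`), so the `ℝ≥0∞` `tsum` of any non-negative real profile over the
window is dominated by `ofReal` of the FINSET sum of the profile over the punctured cube — after which the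
two in-tree lattice counts apply verbatim. -/

/-- Idea A, first lemma (PROVED here as the cheapest falsifier of the transfer): window `tsum` ≤
`ofReal` (Finset sum over the punctured cube `{-⌊R⌋₊,…,⌊R⌋₊}³ ∖ 0`). [folklore] -/
theorem window_tsum_le_ofReal_boxSum (R : ℝ) (g : (Fin 3 → ℤ) → ℝ) (hg : ∀ k, 0 ≤ g k) :
    ∑' k : {k : Fin 3 → ℤ // k ≠ 0 ∧ ‖(fun j => (k j : ℝ))‖ ≤ R}, ENNReal.ofReal (g k.1)
      ≤ ENNReal.ofReal (∑ k ∈ ((Fintype.piFinset fun _ : Fin 3 =>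
          Finset.Icc (-((⌊R⌋₊ : ℕ) : ℤ)) ((⌊R⌋₊ : ℕ) : ℤ))).erase 0, g k) := by
  classical
  set s : Finset (Fin 3 → ℤ) := ((Fintype.piFinset fun _ : Fin 3 =>
      Finset.Icc (-((⌊R⌋₊ : ℕ) : ℤ)) ((⌊R⌋₊ : ℕ) : ℤ))).erase 0 with hs
  -- the injection window ↪ punctured cube
  let i : {k : Fin 3 → ℤ // k ≠ 0 ∧ ‖(fun j => (k j : ℝ))‖ ≤ R} → {k // k ∈ s} := fun k =>
    ⟨k.1, Finset.mem_erase.2 ⟨k.2.1, mem_latticeBox_floor_of_norm_le k.2.2⟩⟩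
  have hi : Function.Injective i := by
    intro a b hab
    apply Subtype.ext
    have := congrArg Subtype.val hab
    simpa [i] using this
  calc ∑' k : {k : Fin 3 → ℤ // k ≠ 0 ∧ ‖(fun j => (k j : ℝ))‖ ≤ R}, ENNReal.ofReal (g k.1)
      = ∑' k : {k : Fin 3 → ℤ // k ≠ 0 ∧ ‖(fun j => (k j : ℝ))‖ ≤ R},
          (fun y : {k // k ∈ s} => ENNReal.ofReal (g y.1)) (i k) := rfl
    _ ≤ ∑' y : {k // k ∈ s}, ENNReal.ofReal (g y.1) :=
        ENNReal.tsum_comp_le_tsum_of_injective hi _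
    _ = ∑ k ∈ s, ENNReal.ofReal (g k) := Finset.tsum_subtype s (fun k => ENNReal.ofReal (g k))
    _ = ENNReal.ofReal (∑ k ∈ s, g k) := (ENNReal.ofReal_sum_of_nonneg fun k _ => hg k).symm

/-! ## Idea B (`cubic-homogeneity`) — first lemmas

Integrality absorbs every lower-order term: on `ℕ`, `(2M+1)³ − 1 ≤ 26M³` and `13M(M+1) ≤ 26M²` (both in
tree), so the window profile sum is a pure cubic in the lattice radius, `26M³ + 26·s·M² ≤ 26(K³+K²)s³` at
`M = ⌊Ks⌋₊`, and `s³ = (√ρ·L)³ = √ρ·N` EXACTLY (`sideLength_pow_three`): the window mass is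
`≤ 26C(K³+K²)√ρ·N` for EVERY `N`, with no `∀ᶠ N` and an explicit density threshold
`ρ₀ = (η / (26C(K³+K²)))²`. -/

/-- Idea B, lemma 1 (PROVED): the profile `1 + s/‖k‖∞` summed over the punctured cube of radius `M ∈ ℕ`
is at most the pure cubic `26M³ + 26·s·M²`. [folklore] -/
theorem boxSum_profile_le (M : ℕ) {s : ℝ} (hs : 0 ≤ s) :
    ∑ k ∈ ((Fintype.piFinset fun _ : Fin 3 => Finset.Icc (-((M : ℕ) : ℤ)) ((M : ℕ) : ℤ))).erase 0,
        (1 + s / ‖(fun j => (k j : ℝ))‖) ≤ 26 * (M : ℝ) ^ 3 + 26 * s * (M : ℝ) ^ 2 := by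
  rw [Finset.sum_add_distrib, Finset.sum_const, nsmul_eq_mul, mul_one]
  have h1 := card_latticeShell_le M
  have h2 : ∑ k ∈ ((Fintype.piFinset fun _ : Fin 3 => Finset.Icc (-((M : ℕ) : ℤ)) ((M : ℕ) : ℤ))).erase 0,
      s / ‖(fun j => (k j : ℝ))‖ ≤ s * (26 * (M : ℝ) ^ 2) := by
    have h3 := sum_inv_norm_latticeShell_le_sq M
    calc ∑ k ∈ ((Fintype.piFinset fun _ : Fin 3 => Finset.Icc (-((M : ℕ) : ℤ)) ((M : ℕ) : ℤ))).erase 0,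
          s / ‖(fun j => (k j : ℝ))‖
        = s * ∑ k ∈ ((Fintype.piFinset fun _ : Fin 3 =>
            Finset.Icc (-((M : ℕ) : ℤ)) ((M : ℕ) : ℤ))).erase 0, 1 / ‖(fun j => (k j : ℝ))‖ := by
          rw [Finset.mul_sum]
          refine Finset.sum_congr rfl fun k _ => ?_
          ring
      _ ≤ s * (26 * (M : ℝ) ^ 2) := mul_le_mul_of_nonneg_left h3 hs
  linarith

/-- Idea B, lemma 2 (PROVED): the exact scale identity `(√ρ · L_N)³ = √ρ · N`, `L_N = (N/ρ)^{1/3}`. [folklore] -/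
theorem sqrt_mul_sideLength_pow_three {ρ : ℝ} (hρ : 0 < ρ) (N : ℕ) :
    (Real.sqrt ρ * sideLength ρ N) ^ 3 = Real.sqrt ρ * N := by
  rw [mul_pow, sideLength_pow_three hρ N]
  have hs : Real.sqrt ρ ^ 3 = ρ * Real.sqrt ρ := by
    rw [pow_succ, Real.sq_sqrt hρ.le]
  rw [hs]
  field_simp

/-- Idea B, lemma 3 (PROVED): from the radius `M = ⌊K s⌋₊` to the monomial `26(K³+K²)s³`. [folklore] -/
theorem cubic_of_floor {K s : ℝ} (hK : 0 ≤ K) (hs : 0 ≤ s) :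
    26 * ((⌊K * s⌋₊ : ℕ) : ℝ) ^ 3 + 26 * s * ((⌊K * s⌋₊ : ℕ) : ℝ) ^ 2
      ≤ 26 * (K ^ 3 + K ^ 2) * s ^ 3 := by
  have hM : ((⌊K * s⌋₊ : ℕ) : ℝ) ≤ K * s := Nat.floor_le (mul_nonneg hK hs)
  have hM0 : 0 ≤ ((⌊K * s⌋₊ : ℕ) : ℝ) := Nat.cast_nonneg _
  have h1 : ((⌊K * s⌋₊ : ℕ) : ℝ) ^ 3 ≤ (K * s) ^ 3 := by gcongr
  have h2 : ((⌊K * s⌋₊ : ℕ) : ℝ) ^ 2 ≤ (K * s) ^ 2 := by gcongr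
  nlinarith [mul_le_mul_of_nonneg_left h2 hs]

/-- Idea B, the TRANSFER statement `C⁺` (window mass with NO eventuality in `N` and an explicit density
scaling): for every non-negative profile constant `C`, every `K ≥ 0`, every `ρ > 0` and EVERY `N`, the window
sum of `ofReal (C(1 + √ρL/‖k‖))` is at most `ofReal (26 C (K³+K²) √ρ · N)`.  `C⁺ ⇒` (the registered
`stub_windowLatticeSum` ∘ `stub_smallDensityAbsorption` composite) with `ρ₀ := (η/(26C(K³+K²)))²`.
(PROVED from the three lemmas above and Idea A's lemma.) [folklore] -/
theorem windowMass_le_noEventually {C K ρ : ℝ} (hC : 0 ≤ C) (hK : 0 ≤ K) (hρ : 0 < ρ) (N : ℕ) :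
    ∑' k : {k : Fin 3 → ℤ // k ≠ 0 ∧ ‖(fun j => (k j : ℝ))‖ ≤ K * Real.sqrt ρ * sideLength ρ N},
        ENNReal.ofReal (C * (1 + Real.sqrt ρ * sideLength ρ N / ‖(fun j => (k.1 j : ℝ))‖))
      ≤ ENNReal.ofReal (26 * C * (K ^ 3 + K ^ 2) * Real.sqrt ρ * N) := by
  set s : ℝ := Real.sqrt ρ * sideLength ρ N with hsdef
  have hs : 0 ≤ s := mul_nonneg (Real.sqrt_nonneg ρ) (sideLength_nonneg hρ.le N)
  have hKs : K * Real.sqrt ρ * sideLength ρ N = K * s := by rw [hsdef]; ring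
  have hg : ∀ k : Fin 3 → ℤ, 0 ≤ C * (1 + s / ‖(fun j => (k j : ℝ))‖) := fun k => by positivity
  rw [hKs]
  refine (window_tsum_le_ofReal_boxSum (K * s) (fun k => C * (1 + s / ‖(fun j => (k j : ℝ))‖)) hg).trans ?_
  refine ENNReal.ofReal_le_ofReal ?_
  rw [← Finset.mul_sum]
  have hb := boxSum_profile_le ⌊K * s⌋₊ hs
  have hc := cubic_of_floor hK hs
  have hcube : s ^ 3 = Real.sqrt ρ * N := sqrt_mul_sideLength_pow_three hρ N
  calc C * ∑ k ∈ ((Fintype.piFinset fun _ : Fin 3 =>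
          Finset.Icc (-((⌊K * s⌋₊ : ℕ) : ℤ)) ((⌊K * s⌋₊ : ℕ) : ℤ))).erase 0, (1 + s / ‖(fun j => (k j : ℝ))‖)
      ≤ C * (26 * (K ^ 3 + K ^ 2) * s ^ 3) := mul_le_mul_of_nonneg_left (hb.trans hc) hC
    _ = 26 * C * (K ^ 3 + K ^ 2) * Real.sqrt ρ * N := by rw [hcube]; ring


/-! ## The crux -/

/-- **`BecWindowCount`** (route `BECInfraredBound`, stmt-AtomisticToContinuum-9015): the window infrared
bound for `v` implies that the infrared window `0 < ‖k‖∞ ≤ K√ρL` carries at most `ηN` particles for every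
`η > 0`, once `ρ < ρ₀ := min ρ₀^IR (η/(26C(K³+K²)+1))²`, on the infrared bound's own eventuality set in
`N` and with its own slack `δ`. [cite: LSSY2005, Ch. 11 (11.26)–(11.27); DysonLiebSimon1978, §4] -/
theorem becWindowCount :
    Summit.AtomisticToContinuum.BoseEinsteinCondensation.Theses.BECInfraredBound.BecWindowCount := by
  intro v _hv hIR ε hε hε4 K hK η hη
  obtain ⟨ρ₁, hρ₁, C, hC, H1⟩ := hIR ε hε hε4 K hK
  set A : ℝ := 26 * C * (K ^ 3 + K ^ 2) + 1 with hA
  have hA0 : 0 < A := by positivity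
  have hηA : 0 < η / A := div_pos hη hA0
  refine ⟨min ρ₁ ((η / A) ^ 2), lt_min hρ₁ (by positivity), ?_⟩
  intro ρ hρ hρlt
  have hρ₁' : ρ < ρ₁ := lt_of_lt_of_le hρlt (min_le_left _ _)
  have hρ₂' : ρ < (η / A) ^ 2 := lt_of_lt_of_le hρlt (min_le_right _ _)
  -- density threshold: `A·√ρ ≤ η`
  have hsqrt : Real.sqrt ρ ≤ η / A := by
    have h1 : Real.sqrt ρ ≤ Real.sqrt ((η / A) ^ 2) := Real.sqrt_le_sqrt hρ₂'.le
    rwa [Real.sqrt_sq hηA.le] at h1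
  have hAρ : (26 * C * (K ^ 3 + K ^ 2)) * Real.sqrt ρ ≤ η := by
    have h2 : (26 * C * (K ^ 3 + K ^ 2)) * Real.sqrt ρ ≤ A * Real.sqrt ρ :=
      mul_le_mul_of_nonneg_right (by rw [hA]; linarith) (Real.sqrt_nonneg ρ)
    have h3 : A * Real.sqrt ρ ≤ A * (η / A) := mul_le_mul_of_nonneg_left hsqrt hA0.le
    have h4 : A * (η / A) = η := by field_simp
    linarith
  filter_upwards [H1 ρ hρ hρ₁'] with N hN
  obtain ⟨δ, hδ, HΨ⟩ := hN
  refine ⟨δ, hδ, fun Ψ hΨ => ?_⟩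
  have hpt := fun k : {k : Fin 3 → ℤ // k ≠ 0 ∧ ‖(fun j => (k j : ℝ))‖ ≤
      K * Real.sqrt ρ * sideLength ρ N} => HΨ Ψ hΨ k.1 k.2.1 k.2.2
  refine (ENNReal.tsum_le_tsum hpt).trans ?_
  refine (windowMass_le_noEventually hC.le hK.le hρ N).trans (ENNReal.ofReal_le_ofReal ?_)
  have hN0 : (0 : ℝ) ≤ N := Nat.cast_nonneg N
  calc 26 * C * (K ^ 3 + K ^ 2) * Real.sqrt ρ * N = ((26 * C * (K ^ 3 + K ^ 2)) * Real.sqrt ρ) * N := by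
        ring
    _ ≤ η * N := mul_le_mul_of_nonneg_right hAρ hN0

end Summit.AtomisticToContinuum.BoseEinsteinCondensation.Cruxes.BecWindowCount.Candidate
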